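import Summits.BirchSwinnertonDyer.BirchSwinnertonDyer.Theorems.ErratumRoadFiveEulerHalfGenusTwinsDefs
import Summits.BirchSwinnertonDyer.BirchSwinnertonDyer.Theorems.ClassRecordThreeEulerHalvesAtThreeKolyvaginFamilyDataDefs
import Summits.BirchSwinnertonDyer.BirchSwinnertonDyer.Theorems.ClassRecordThreeCornerAtThreeShimuraWalkDefs
import HarnessLib

/-!
# The genus line on `EulerHalfPOnlyMultPotMultTwinAtFive` — Defs III: the genus family AS A `JET.KolyvaginFamilyData`; its Kolyvagin
# classes; the labelled-family supply `GenusLabelsSupply`; the sign bookkeeping of the transport (proved)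

Sequel of `ErratumRoadFiveEulerHalfGenusTwinsDefs.lean` (Defs II).  Declarations VERBATIM (byte-identical) from the line owner's workfile
`Cruxes/EulerHalfNotRamNoInertSetAtFive/Lines/genus_gen5_classdefs.lean` (seat `bsd-idea-9` g26, commit 7031a224225b, sha16 0f0c8f330249c5fb,
cell bus STATUS 2026-08-29T14:33:17Z), landed under `Theorems/` by prover seat `bsd-stepL-imc-p1` g41 on the pen's relay (`bsd-stepL-plan` g46,
STATUS 2026-08-29T14:42:59Z; planners are refused under `Theorems/`, D-0016) as a helper `--supports stmt-BirchSwinnertonDyer-23444`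
(line `genus` v2.0-LINE, stub `stub_genusClassDataSupply`); imports NO `Theses` file directly and its import closure does NOT reach
`Theses.ErratumRoadFive` (through Defs II it does reach `Theses.AdditiveKolyvaginRoad`, exactly as Defs II already does — pen g46 RULING 112,
finding (2)).  Only this module docstring and one justification comment differ from the workfile.

The (b2b-κ) child `GenusLine.GenusClassDataSupply` asks for classes `κ_c, κ_{cℓ} ∈ H¹(K, W[p^k])` "of" the genus family
points `genusFamilyPoint … δ ∈ W(K[c])` with [J] §3.1 item 7 ∕ [G] 5.4 (ii) ∕ 6.2 (1) ∕ [J] 4.9♯ ∕ [J] 4.7-type properties.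
DESIGN (memo `Cruxes/EulerHalfNotRamNoInertSetAtFive/Lines/genus_gen5_design.md` §F): the tree already carries the
datum-generic Kolyvagin package of cell `bsd-stepL` — the structure
`Summit.BirchSwinnertonDyer.Rank1Residual.JET.KolyvaginFamilyData W K ι n` (`…Theorems.ClassRecordThreeEulerHalvesAtThreeKolyvaginFamilyDataDefs`,
Theses-free) with `derivedPoint ∕ toGeomPoints ∕ pointsSubgroup ∕ kolyvaginClass`, and — over families satisfying the printed
labels `ShimuraWalk.LabelsAt W N K ι yK ys ε` — the class theorems BY NAME (`KolyvaginFamilyData.zsmul_kolyvaginClass_eq_zero_iff`,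
`….addOrderOf_kolyvaginClass_of_exactDepth` — McCallum Cor. 4.5 ∕ p. 305; `toGeomPoints_derivedPoint_familyData_mem_invPoints` —
Gross Prop. 3.6 invariance; `addOrderOf_localization_kolyvaginClass_familyData_eq_of_labels` — [J] Prop. 4.7 ⟸ [McC] Prop. 4.4;
`kolyvaginClass_familyData_mem_transverseKer`, `localization_kolyvaginClass_familyData_mem_stringentFamily`,
`conjAct_kolyvaginClass_familyData_eq_sign_smul`, `exists_coherent_familyData_y_eq`, choice-freeness).  So this file
(1) presents a CM-presented genus datum `δ : GenusKolyvaginDatum E′ K ιc Dt β d₁ c` (+ an embedding `e : K[c] → K̄` over `K`)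
    AS a family datum `genusFamilyData … δ e he : JET.KolyvaginFamilyData W K ιc c` with `y := Θ_ϑ(δ.Q)` (`genusTransport`),
    `σ := δ.g`, `S := δ.T`, `emb := e`, and records `(genusFamilyData …).derivedPoint = genusFamilyPoint … δ` (`rfl`);
(2) DEFINES the genus class `genusKolyvaginClass … δ e he hp k := (genusFamilyData …).kolyvaginClass hp k` — so every
    `KolyvaginFamilyData.*` theorem applies to it by name;
(3) TYPES the one genuinely new input of (b2b-κ), `GenusLabelsSupply`: a labelled family `ys` ON `W` (W's own norm ∕ congruence ∕
    eigen labels, `LabelsAt W (N_W) K ιc yK ys ε`) matching every genus datum's transported point up to sign,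
    `Θ_ϑ(δ.Q) = ± ys c` (all class-level conclusions are sign-invariant);
(4) PROVES the sign bookkeeping behind (3): along `Θ_ϑ` Gross's relations for `E′` arrive on `W` twisted by `χ_{d₁}(ℓ) = (d₁/ℓ)`
    — in (B4) through `a_ℓ(E′) = (d₁/ℓ)·a_ℓ(W)`, in (B5) through `Frob_ℓ ϑ̄ = (d₁/ℓ)·ϑ̄` — and the SIGN-CORRECTED family
    `ys c := J(d₁ | c) • Θ_ϑ(Q_c)` (Jacobi symbol = `∏_{ℓ ∣ c} (d₁/ℓ)` for square-free `c`) satisfies W's relations EXACTLY: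
    `genusSign_*` (multiplicativity `J(d₁|c) = J(d₁|c/ℓ)·(d₁/ℓ)`, `J² = 1`) and the two abstract transfer lemmas
    `sum_signed_eq_of_sum_eq_twisted` (norm) ∕ `map_signed_eq_of_map_eq_twisted` (congruence).
Vocabulary + algebra only; (3) is a NAMED OPEN INPUT (`@[conjecture]`-tagged, nothing asserted; cell convention RULING 75).
HONEST FRAMING: no named fact, no `sorry`, no axiom; no summit statement is touched; no crux or stub is closed; BSD is proved for no curve.
References: [cite: GrossLMS1991, §3 Prop. 3.7, §4 (4.1)–(4.6), Cor. 4.5 ∕ Prop. 4.7] [cite: McCallumLMS1991, §4 Prop. 4.4, Cor. 4.5, §5 p. 305]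
[cite: Jetchev2008, §3.1 item 7, Prop. 4.7, Prop. 4.9, Thm. 5.2] [cite: SilvermanAEC2009, X.§2 Prop. 2.4 ∕ Ex. 10.15 (twist: a_ℓ(E^d) = (d/ℓ) a_ℓ(E))]
REVISION Defs III′ (line owner bsd-idea-9 g26, memo §F.8): the identification clause of `GenusLabelsSupply` is GUARDED by
`c ≠ 0 → c.Coprime N_{E′} →` (provable shape: `GenusLine.genusLabelsAt_of_facts`, p726922); nothing else changes.
-/

set_option autoImplicit false
-- D-0017: single-problem summit, so `Summit.BirchSwinnertonDyer.BirchSwinnertonDyer.…` repeats a namespace BY DESIGN.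
set_option linter.dupNamespace false

noncomputable section

open scoped Classical NumberTheorySymbols
open WeierstrassCurve Literature.NumberTheory.EllipticCurves
open Literature.NumberTheory.EllipticCurves.ModularForms
open Summit.BirchSwinnertonDyer.Rank1Residual

namespace Summit.BirchSwinnertonDyer.BirchSwinnertonDyer.Theorems.GenusLine

/-! ## §1 The genus transport `Θ_ϑ Q ∈ W(K[m])` and the genus datum as a `KolyvaginFamilyData` -/

/-- **The genus transport `Θ_ϑ(Q) ∈ W(K[m])`** of the datum's point `Q ∈ E′(K[m])` along the presentation
`C₂ • (D • E′)^{(d₁)} = W` untwisted at `ϑ` (`ϑ² = d₁`) — VERBATIM the argument of `KolyvaginOperator.derivedPoint` in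
`genusFamilyPoint`. [vocabulary; cite: SilvermanAEC2009, X.§2 (quadratic twist, isomorphism over `K(√d)`)] -/
def genusTransport (W E' : WeierstrassCurve ℚ) (D C₂ : VariableChange ℚ) [(D • E').IsCharNeTwoNF] {d₁ : ℤ}
    (hWd : C₂ • (D • E').quadraticTwist (d₁ : ℚ) = W) (K : Type) [Field K] [NumberField K] (ιc : K →+* ℂ)
    {NE : ℕ} [NeZero NE] {Dt : ModularParametrizationData E' NE} {β : ℤ} {m : ℕ}
    (δ : GenusKolyvaginDatum E' K ιc Dt β d₁ m) : (W.baseChange (ringClassField K ιc m : Type)).toAffine.Point :=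
  Affine.Point.congrEquiv (congrArg (fun X : WeierstrassCurve ℚ ↦ X.baseChange (ringClassField K ιc m : Type)) hWd)
    (VariableChange.pointEquivBaseChange ((D • E').quadraticTwist (d₁ : ℚ)) C₂ (ringClassField K ιc m)
      ((VariableChange.pointEquiv (((D • E').quadraticTwist (d₁ : ℚ)).baseChange
          (ringClassField K ιc m : Type)) (untwistAt δ.hϑ0)).symm
        ((Affine.Point.congrEquiv (untwistAt_smul_eq (D • E') δ.hϑ2 δ.hϑ0)).symm
          (VariableChange.pointEquivBaseChange E' D (ringClassField K ιc m) δ.Q))))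

/-- `P(m, δ) = D_m(Θ_ϑ Q)`: the family point IS Kolyvagin's derived point of the transport (definitional). [folklore] -/
theorem genusFamilyPoint_eq_derivedPoint_genusTransport (W E' : WeierstrassCurve ℚ) (D C₂ : VariableChange ℚ)
    [(D • E').IsCharNeTwoNF] {d₁ : ℤ} (hWd : C₂ • (D • E').quadraticTwist (d₁ : ℚ) = W)
    (K : Type) [Field K] [NumberField K] (ιc : K →+* ℂ) {NE : ℕ} [NeZero NE] {Dt : ModularParametrizationData E' NE}
    {β : ℤ} {m : ℕ} (δ : GenusKolyvaginDatum E' K ιc Dt β d₁ m) :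
    genusFamilyPoint W E' D C₂ hWd K ιc δ =
      KolyvaginOperator.derivedPoint (pointGalHom W (ringClassField K ιc m)) δ.g m δ.T
        (genusTransport W E' D C₂ hWd K ιc δ) := rfl

/-- **The genus datum AS a Kolyvagin family datum on `W`** (cell bsd-stepL's datum-generic structure
`JET.KolyvaginFamilyData`): `y := Θ_ϑ(δ.Q)`, generators `δ.g`, transversal `δ.T`, and an embedding `e : K[m] → K̄` over `K`
(an ARGUMENT: the CM-presented datum has no `emb` field). [vocabulary; cite: GrossLMS1991, §3–§4] -/
def genusFamilyData (W E' : WeierstrassCurve ℚ) (D C₂ : VariableChange ℚ) [(D • E').IsCharNeTwoNF] {d₁ : ℤ}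
    (hWd : C₂ • (D • E').quadraticTwist (d₁ : ℚ) = W) (K : Type) [Field K] [NumberField K] (ιc : K →+* ℂ)
    {NE : ℕ} [NeZero NE] {Dt : ModularParametrizationData E' NE} {β : ℤ} {m : ℕ}
    (δ : GenusKolyvaginDatum E' K ιc Dt β d₁ m) (e : ringClassField K ιc m →+* AlgebraicClosure K)
    (he : ∀ k : K, e (algebraMap K (ringClassField K ιc m) k) = algebraMap K (AlgebraicClosure K) k) :
    JET.KolyvaginFamilyData W K ιc m where
  y := genusTransport W E' D C₂ hWd K ιc δ
  σ := δ.g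
  zpowers_σ := δ.hg
  S := δ.T
  S_subset := δ.hT
  S_transversal := δ.hT'
  emb := e
  emb_apply := he

section Dictionary

variable {W E' : WeierstrassCurve ℚ} {D C₂ : VariableChange ℚ} [(D • E').IsCharNeTwoNF] {d₁ : ℤ}
  {hWd : C₂ • (D • E').quadraticTwist (d₁ : ℚ) = W} {K : Type} [Field K] [NumberField K] {ιc : K →+* ℂ}
  {NE : ℕ} [NeZero NE] {Dt : ModularParametrizationData E' NE} {β : ℤ} {m : ℕ}
  (δ : GenusKolyvaginDatum E' K ιc Dt β d₁ m) (e : ringClassField K ιc m →+* AlgebraicClosure K)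
  (he : ∀ k : K, e (algebraMap K (ringClassField K ιc m) k) = algebraMap K (AlgebraicClosure K) k)

/-- Dictionary: the point is the transport. [folklore] -/
@[simp] theorem genusFamilyData_y : (genusFamilyData W E' D C₂ hWd K ιc δ e he).y = genusTransport W E' D C₂ hWd K ιc δ := rfl

/-- Dictionary: the generators. [folklore] -/
@[simp] theorem genusFamilyData_σ : (genusFamilyData W E' D C₂ hWd K ιc δ e he).σ = δ.g := rfl

/-- Dictionary: the transversal. [folklore] -/
@[simp] theorem genusFamilyData_S : (genusFamilyData W E' D C₂ hWd K ιc δ e he).S = δ.T := rfl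

/-- Dictionary: the embedding. [folklore] -/
@[simp] theorem genusFamilyData_emb : (genusFamilyData W E' D C₂ hWd K ιc δ e he).emb = e := rfl

/-- **Dictionary: the derived point of the family datum IS the genus family point `P(m, δ)`** (definitional).
[cite: GrossLMS1991, §4 (4.1)] -/
@[simp] theorem genusFamilyData_derivedPoint :
    (genusFamilyData W E' D C₂ hWd K ιc δ e he).derivedPoint = genusFamilyPoint W E' D C₂ hWd K ιc δ := rfl

/-- Dictionary: `W(K[m]) → W(K̄)` is the map along `e`. [folklore] -/
theorem genusFamilyData_toGeomPoints :
    (genusFamilyData W E' D C₂ hWd K ιc δ e he).toGeomPoints = Affine.Point.map (W' := W) e.toRatAlgHom := rfl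

end Dictionary

/-! ## §2 The Kolyvagin class of the genus family point -/

/-- **The Kolyvagin class `κ_{m,k}(δ, e) ∈ H¹(K, W[p^k])` of the genus family point `P(m, δ) ∈ W(K[m])`** — BY DEFINITION the
class `KolyvaginFamilyData.kolyvaginClass` of the family datum `genusFamilyData … δ e he` (McCallum's cocycle of `e(P(m, δ))`
relative to `A = W(K[m]) ⊆ W(K̄)`, junk `0` off the admissible ∕ invariant locus), so that the datum-generic class theorems of
cell bsd-stepL apply to it verbatim. [cite: GrossLMS1991, §4 (4.4), (4.6)] [cite: Jetchev2008, §3.1 (κ_{c,m})] -/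
def genusKolyvaginClass (W E' : WeierstrassCurve ℚ) (D C₂ : VariableChange ℚ) [(D • E').IsCharNeTwoNF] {d₁ : ℤ}
    (hWd : C₂ • (D • E').quadraticTwist (d₁ : ℚ) = W) (K : Type) [Field K] [NumberField K] (ιc : K →+* ℂ)
    {NE : ℕ} [NeZero NE] {Dt : ModularParametrizationData E' NE} {β : ℤ} {m : ℕ}
    (δ : GenusKolyvaginDatum E' K ιc Dt β d₁ m) (e : ringClassField K ιc m →+* AlgebraicClosure K)
    (he : ∀ k : K, e (algebraMap K (ringClassField K ιc m) k) = algebraMap K (AlgebraicClosure K) k)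
    {p : ℕ} (hp : p.Prime) (k : ℕ) : galH1Torsion (W.baseChange K) ((p ^ k : ℕ) : ℤ) :=
  (genusFamilyData W E' D C₂ hWd K ιc δ e he).kolyvaginClass hp k

/-- Dictionary: the genus class is the family datum's class (definitional) — rewrite with this, then use
`JET.KolyvaginFamilyData.zsmul_kolyvaginClass_eq_zero_iff ∕ addOrderOf_kolyvaginClass_of_exactDepth ∕ …`. [folklore] -/
theorem genusKolyvaginClass_eq {W E' : WeierstrassCurve ℚ} {D C₂ : VariableChange ℚ} [(D • E').IsCharNeTwoNF] {d₁ : ℤ}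
    {hWd : C₂ • (D • E').quadraticTwist (d₁ : ℚ) = W} {K : Type} [Field K] [NumberField K] {ιc : K →+* ℂ}
    {NE : ℕ} [NeZero NE] {Dt : ModularParametrizationData E' NE} {β : ℤ} {m : ℕ}
    (δ : GenusKolyvaginDatum E' K ιc Dt β d₁ m) (e : ringClassField K ιc m →+* AlgebraicClosure K)
    (he : ∀ k : K, e (algebraMap K (ringClassField K ιc m) k) = algebraMap K (AlgebraicClosure K) k)
    {p : ℕ} (hp : p.Prime) (k : ℕ) :
    genusKolyvaginClass W E' D C₂ hWd K ιc δ e he hp k =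
      (genusFamilyData W E' D C₂ hWd K ιc δ e he).kolyvaginClass hp k := rfl

/-! ## §3 The labelled-family supply ON `W` (the one new input of (b2b-κ); open, nothing asserted) -/

/-- **(b2b-L) GENUS LABELS ON `W`** — the single new input of the class-data child (b2b-κ) in the family currency: on every
genus setting `S` with the served `FrameProfile`, there is a family `ys : (m : ℕ) → W(K[m])` carrying W's OWN printed labels
`ShimuraWalk.LabelsAt W N_W K S.ιc yK ys ε` ((B2) bottom trace, (B3)/(B3₀) `τ`-eigen up to torsion, (B4) Gross 3.7 (1) norm
relation with `a_ℓ(W)`, (B5) Gross 3.7 (2) ∕ Nekovář congruence) such that EVERY CM-presented genus datum's transported point AT A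
GENUINE LEVEL (`c ≠ 0` coprime to `N_{E′}` — every Kolyvagin level is one; at junk levels the pinning `δ.hQ` is to a junk complex
value and says nothing: revision Defs III′, g26) is `± ys`: `Θ_ϑ(δ.Q) = ys c ∨ Θ_ϑ(δ.Q) = −ys c`.  Intended witness (§4 below): `ys c := J(S.d₁ | c) • Θ_θ(Q_c)` with the
setting's `θ ∈ K[1] ⊆ K[c]` — the relations of `E′`'s CM family (Literature: Gross 3.7 ∕ Nekovář 4.9 for `S.Dt`) transported
along `Θ_θ` pick up `(d₁/ℓ)` in (B4) (`a_ℓ(E′) = (d₁/ℓ) a_ℓ(W)`) and in (B5) (`Frob_ℓ θ̄ = (d₁/ℓ) θ̄`), which the Jacobi sign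
absorbs exactly; the `τ`-sign becomes `ε_{E′} · sign(d₁)`; a datum's own `ϑ = ±θ` only flips the sign.  Why it might fail:
(B5) needs «reduction mod `λ_m` commutes with the untwisting isomorphism over `𝔽_λ ∋ θ̄`» for the tree's `geomReduction`, and
(B2)/(B3₀) need the bottom point `yK` with W's eigen-sign — bookkeeping, but over three variable changes.  Open AS TYPED;
vocabulary, nothing asserted. [cite: GrossLMS1991, Prop. 3.7, Prop. 5.3] [cite: Nekovar2007, (4.8), (4.9)]
[cite: SilvermanAEC2009, X.§2] -/
@[conjecture]
def GenusLabelsSupply : Prop :=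
  ∀ (W : WeierstrassCurve ℚ) [W.IsElliptic] [W.IsGloballyMinimal]
    (A : WeierstrassCurve ℚ) [A.IsElliptic] [A.IsGloballyMinimal] (p q : ℕ) [Fact p.Prime] [Fact q.Prime]
    (K : Type) [Field K] [NumberField K] (S : GenusHeegnerSettingRC W A p q K),
    FrameProfile W A p q K →
    haveI := S.ell; haveI := S.min; haveI := S.nz; haveI := S.nf
    ∃ (yK : (W.baseChange K).toAffine.Point)
      (ys : (m : ℕ) → (W.baseChange (ringClassField K S.ιc m : Type)).toAffine.Point) (ε : ℤ),
      ShimuraWalk.LabelsAt W (W.conductorNorm ℤ) K S.ιc yK ys ε ∧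
      ∀ (c : ℕ), c ≠ 0 → c.Coprime (S.E'.conductorNorm ℤ) →
        ∀ (δ : GenusKolyvaginDatum S.E' K S.ιc S.Dt S.β S.d₁ c),
          genusTransport W S.E' S.D S.C₂ S.hWd K S.ιc δ = ys c ∨
            genusTransport W S.E' S.D S.C₂ S.hWd K S.ιc δ = -ys c

/-! ## §4 The sign bookkeeping of the transport (proved) -/

/-- **The genus sign `s(c) = J(d₁ | c)`** (Jacobi symbol; for square-free `c` coprime to `d₁` it is `∏_{ℓ ∣ c} (d₁/ℓ) = ±1`):
the correction making the transported CM family satisfy W's Euler-system relations on the nose. [folklore] -/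
def genusSign (d₁ : ℤ) (c : ℕ) : ℤ := J(d₁ | c)

/-- `s(1) = 1`. [folklore] -/
@[simp] theorem genusSign_one (d₁ : ℤ) : genusSign d₁ 1 = 1 := jacobiSym.one_right d₁

/-- `s(0) = 1` (junk level). [folklore] -/
@[simp] theorem genusSign_zero (d₁ : ℤ) : genusSign d₁ 0 = 1 := jacobiSym.zero_right d₁

/-- At a prime: `s(ℓ) = (d₁/ℓ)` (Legendre symbol). [folklore] -/
theorem genusSign_prime (d₁ : ℤ) (ℓ : ℕ) [Fact ℓ.Prime] : genusSign d₁ ℓ = legendreSym ℓ d₁ :=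
  (jacobiSym.legendreSym.to_jacobiSym ℓ d₁).symm

/-- **Multiplicativity along `c ∣ cℓ`**: `s(c) = s(c/ℓ) · s(ℓ)` for `ℓ ∣ c ≠ 0`. [folklore] -/
theorem genusSign_eq_div_mul (d₁ : ℤ) {c ℓ : ℕ} (hc : c ≠ 0) (hℓc : ℓ ∣ c) :
    genusSign d₁ c = genusSign d₁ (c / ℓ) * genusSign d₁ ℓ := by
  have hℓ0 : ℓ ≠ 0 := by rintro rfl; exact hc (Nat.eq_zero_of_zero_dvd hℓc)
  have hq0 : c / ℓ ≠ 0 := by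
    intro h; exact hc (by simpa [h] using (Nat.div_mul_cancel hℓc).symm)
  unfold genusSign
  rw [← jacobiSym.mul_right' d₁ hq0 hℓ0, Nat.div_mul_cancel hℓc]

/-- At a prime factor: `s(c) = s(c/ℓ) · (d₁/ℓ)`. [folklore] -/
theorem genusSign_eq_div_mul_legendreSym (d₁ : ℤ) {c ℓ : ℕ} (hℓ : ℓ ∈ c.primeFactors) :
    haveI : Fact ℓ.Prime := ⟨Nat.prime_of_mem_primeFactors hℓ⟩
    genusSign d₁ c = genusSign d₁ (c / ℓ) * legendreSym ℓ d₁ := by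
  haveI : Fact ℓ.Prime := ⟨Nat.prime_of_mem_primeFactors hℓ⟩
  rw [← genusSign_prime]
  exact genusSign_eq_div_mul d₁ (Nat.mem_primeFactors.mp hℓ).2.2 (Nat.dvd_of_mem_primeFactors hℓ)

/-- `s(c) = ±1` when `gcd(d₁, c) = 1`. [folklore] -/
theorem genusSign_eq_one_or (d₁ : ℤ) {c : ℕ} (h : d₁.gcd c = 1) : genusSign d₁ c = 1 ∨ genusSign d₁ c = -1 :=
  jacobiSym.eq_one_or_neg_one h

/-- `s(c) · s(c) = 1` when `gcd(d₁, c) = 1`. [folklore] -/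
theorem genusSign_mul_self (d₁ : ℤ) {c : ℕ} (h : d₁.gcd c = 1) : genusSign d₁ c * genusSign d₁ c = 1 := by
  rw [← sq]; exact jacobiSym.sq_one h

/-- **Transfer of a NORM-type relation to the sign-corrected family** (abstract (B4)): if `T Y = (χ·a) • ι Y′` with `χ² = 1`
and the signs satisfy `s = s′·χ`, then `T (s • Y) = a • ι (s′ • Y′)`.  (Instantiated with `T = Σ_{i ≤ ℓ} σ^i` on `W(K[m])`,
`ι = W(K[m/ℓ]) ↪ W(K[m])`, `Y = Θ(Q_m)`, `Y′ = Θ(Q_{m/ℓ})`, `a = a_ℓ(W)`, `χ = (d₁/ℓ)`, `s = s(m)`, `s′ = s(m/ℓ)`.) [folklore] -/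
theorem sum_signed_eq_of_sum_eq_twisted {M N : Type*} [AddCommGroup M] [AddCommGroup N] (T : M →+ M) (ι : N →+ M)
    (Y : M) (Y' : N) (a χ s s' : ℤ) (hχ : χ * χ = 1) (hs : s = s' * χ) (h : T Y = (χ * a) • ι Y') :
    T (s • Y) = a • ι (s' • Y') := by
  rw [map_zsmul, h, map_zsmul, smul_smul, smul_smul, hs]
  congr 1
  calc s' * χ * (χ * a) = s' * (χ * χ) * a := by ring
    _ = s' * a := by rw [hχ, mul_one]
    _ = a * s' := mul_comm _ _

/-- **Transfer of a CONGRUENCE-type relation to the sign-corrected family** (abstract (B5)): if `red Yₙ = χ • F (red Yₘ)`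
with `χ² = 1`, `s = s′·χ`, then `red (s • Yₙ) = F (red (s′ • Yₘ))`.  (Instantiated with `red` = reduction mod `λ_m` of
`W(K[m]) ⊆ W(K̄)`, `F` = the `ℓ`-power Frobenius `φ₀` acting additively, `χ = (d₁/ℓ)` from `φ₀ θ̄ = (d₁/ℓ) θ̄`.) [folklore] -/
theorem map_signed_eq_of_map_eq_twisted {M N : Type*} [AddCommGroup M] [AddCommGroup N] (red : M →+ N) (F : N →+ N)
    (Yn Ym : M) (χ s s' : ℤ) (hχ : χ * χ = 1) (hs : s = s' * χ) (h : red Yn = χ • F (red Ym)) :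
    red (s • Yn) = F (red (s' • Ym)) := by
  rw [map_zsmul, h, map_zsmul, map_zsmul, smul_smul, hs]
  congr 1
  calc s' * χ * χ = s' * (χ * χ) := by ring
    _ = s' := by rw [hχ, mul_one]

/-- **Class-level sign-invariance** (why `± ys` suffices downstream): for `u = ±1`, `u • x` and `x` have the same additive order
and lie in the same subgroups. [folklore] -/
theorem addOrderOf_units_smul_eq {M : Type*} [AddCommGroup M] (x : M) {u : ℤ} (hu : u = 1 ∨ u = -1) :
    addOrderOf (u • x) = addOrderOf x := by
  rcases hu with rfl | rfl
  · rw [one_smul]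
  · rw [neg_one_smul, addOrderOf_neg]

/-- Companion: membership in a subgroup is sign-invariant. [folklore] -/
theorem units_smul_mem_iff {M : Type*} [AddCommGroup M] (H : AddSubgroup M) (x : M) {u : ℤ} (hu : u = 1 ∨ u = -1) :
    u • x ∈ H ↔ x ∈ H := by
  rcases hu with rfl | rfl
  · rw [one_smul]
  · rw [neg_one_smul]; exact neg_mem_iff

end Summit.BirchSwinnertonDyer.BirchSwinnertonDyer.Theorems.GenusLine

end
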